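import Summits.HodgeConjecture.HodgeConjecture.Theorems.MarkmanPartnerTransportPicardThreeK3SquaresZeta11ModelAlgebra
import Summits.HodgeConjecture.HodgeConjecture.Theorems.MarkmanPartnerTransportPicardThreeK3SquaresZeta9TypeOfConj
import Summits.HodgeConjecture.HodgeConjecture.Theorems.MarkmanPartnerTransportPicardThreeK3SquaresSqrt2TypeOfConj
import HarnessLib

/-!
# Route MarkmanPartnerTransport · crux `PicardThreeK3Squares` (stmt-HodgeConjecture-19652) —
# the ζ₁₁ type FORCES Picard number 2; `(X - 2)·P₁₁` annihilates the generator on `T(S)`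

Cell hodge-nonav, crux #4, INDEX row M-θ₁₁ / cell (3,5) (prover seat hodge-nonav-19652-p1 gen 13; `--supports
stmt-HodgeConjecture-19652`, helper). For an arbitrary datum `(g, u₁, u₂, y₀, θ)` of the named fact
`VanGeemenSchuett2025_OguisoZhang2011_zeta11_cycleOnOpenPeriodSet` and a marked projective K3 surface
`(S, η, p, x)` whose endomorphism `t` (type-preserving, killing `N¹(S)`) is conjugate by a rational isometry `σ`
of `Λ_ℚ` to `θ_ℂ` — FACT-FREE consequences of the conjugacy (algebra of the model: `…Zeta11ModelAlgebra`):

* `eigenvalue_ne_zero_of_zeta11Model` — the `(2,0)`-eigenvalue `ev` of `t` is non-zero: otherwise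
  `σx ∈ ker θ_ℂ = ℂu₁ ⊕ ℂu₂`, a rational hyperbolic plane, which contains no period (`(σx.σx) = 0 < (σx̄.σx)`
  is impossible for `σx = a u₁ + b u₂`);
* **`finrank_algebraicClasses_eq_two_of_zeta11Model`** — `ρ(S) = 2`: `ση` maps `N¹(S)_ℂ` ONTO `ker θ_ℂ`
  (rationally spanned by `u₁, u₂`, each the image of an algebraic class by Lefschetz `(1,1)`);
* `piU_apply_eq_zero_of_transcendental` — `ση` maps `T(S)` into `ker π_U = (ℂu₁ ⊕ ℂu₂)^⊥`;
* **`isAnnihilatedOnTranscendentalBy_sextic_of_zeta11Model`** — `Q₁₁(t) = 0` on `T(S)` for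
  `Q₁₁ = (X - 2)(X⁵ + X⁴ - 4X³ - 3X² + 3X + 1)` (`θ_ℂ = g + g⁻¹` off `U`, `g¹¹ = 1`).

NO base-change theory and no use of the integral fixed-lattice clause. No definition, no sorry, no new fact.
References: van Geemen–Schütt, Forum Math. Sigma 13 (2025) e2, Thm. 1.1 (11), §2.1, §4.8, §5.8; Huybrechts,
*Lectures on K3 Surfaces*, Ch. 1 Prop. 3.5, Ch. 3 §3.2, Ch. 6 §1.1.
-/

set_option linter.dupNamespace false

noncomputable section

namespace Summit.HodgeConjecture.HodgeConjecture.Theorems.MarkmanPartnerTransport.RMTypeOrbit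

open CategoryTheory MonoidalCategory Polynomial
open Literature.AlgebraicGeometry Literature.AlgebraicGeometry.Motives Literature.AlgebraicGeometry.HodgeTheory
open Literature.AlgebraicGeometry.Surfaces Literature.LinearAlgebra.QuadraticForm
open Literature.AlgebraicTopology.SingularHomology
open Summit.HodgeConjecture.HodgeConjecture.Theorems.NikulinTwinTransport
open Summit.HodgeConjecture.HodgeConjecture.Theorems.MarkmanPartnerTransport.IsogenyInvariance
open Summit.HodgeConjecture.HodgeConjecture.Theorems.MarkmanPartnerTransport.RMTypeDescent

/-- `MarkedK3[S, η, p, x]`: VERBATIM the `let MarkedK3 := …` binder of the route declaration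
`PicardThreeK3Squares` (as in `…RMTypeDescent`). Local notation only. -/
local notation3 (prettyPrint := false) "MarkedK3[" S ", " η ", " p ", " x "]" =>
  (p ≠ 0 ∧ (IsIntegralClass p ∧
    (∀ q : complexBetti S (2 * 2), IsIntegralClass q → ∃ n : ℤ, q = n • p) ∧
    (∀ c : complexBetti S (2 * 1), IsIntegralClass c ↔ ∃ v : K3Index → ℤ, η c = fun i => (v i : ℂ)) ∧
    (∀ a b : complexBetti S (2 * 1),
      cupProduct (rfl : 2 * 1 + 2 * 1 = 2 * 2) a b = k3Form (η a) (η b) • p) ∧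
    IsOfHodgeType 2 S (2 * 1) 2 0 (LinearEquiv.symm η x) ∧
    (∀ τ : complexBetti S (2 * 1), IsOfHodgeType 2 S (2 * 1) 2 0 τ →
      ∃ t : ℂ, τ = t • LinearEquiv.symm η x)) ∧
    (k3Form x x = 0 ∧ 0 < (k3Form (star x) x).re ∧
      ∃ u : K3Index → ℤ, k3Form (fun i => (u i : ℂ)) x = 0 ∧ 0 < ∑ i, ∑ j, u i * k3Gram i j * u j))

/-- `Zeta11Model[g, u₁, u₂, y₀, θ]`: VERBATIM the antecedents of the named fact
`VanGeemenSchuett2025_OguisoZhang2011_zeta11_cycleOnOpenPeriodSet` (as in `…PicardThreeK3SquaresZeta11Type`).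
Local notation only. -/
local notation3 (prettyPrint := false) "Zeta11Model[" g ", " u₁ ", " u₂ ", " y₀ ", " θ "]" =>
  ((∀ a b : K3Index → ℂ, k3Form (g a) (g b) = k3Form a b) ∧
    (∀ v : K3Index → ℤ, ∃ w : K3Index → ℤ,
      g (fun i => ((v i : ℤ) : ℂ)) = fun i => ((w i : ℤ) : ℂ)) ∧
    g ^ 11 = 1 ∧
    g (fun i => ((u₁ i : ℤ) : ℂ)) = (fun i => ((u₁ i : ℤ) : ℂ)) ∧
    g (fun i => ((u₂ i : ℤ) : ℂ)) = (fun i => ((u₂ i : ℤ) : ℂ)) ∧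
    k3Form (fun i => ((u₁ i : ℤ) : ℂ)) (fun i => ((u₁ i : ℤ) : ℂ)) = 0 ∧
    k3Form (fun i => ((u₂ i : ℤ) : ℂ)) (fun i => ((u₂ i : ℤ) : ℂ)) = 0 ∧
    k3Form (fun i => ((u₁ i : ℤ) : ℂ)) (fun i => ((u₂ i : ℤ) : ℂ)) = 1 ∧
    (∀ v : K3Index → ℤ, g (fun i => ((v i : ℤ) : ℂ)) = (fun i => ((v i : ℤ) : ℂ)) →
      ∃ m n : ℤ, v = m • u₁ + n • u₂) ∧
    k3Form y₀ y₀ = 0 ∧ 0 < (k3Form (star y₀) y₀).re ∧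
    g y₀ = Complex.exp (2 * Real.pi * Complex.I / 11) • y₀ ∧
    (∀ y : K3Index → ℂ, thetaC θ y =
      g y + (g ^ 10) y - (2 * k3Form y (fun i => ((u₂ i : ℤ) : ℂ))) • (fun i => ((u₁ i : ℤ) : ℂ))
        - (2 * k3Form y (fun i => ((u₁ i : ℤ) : ℂ))) • (fun i => ((u₂ i : ℤ) : ℂ))))

/-- `𝓲(u)`: the integral lattice vector `u ∈ Λ` read in `Λ_ℂ`. Local notation only. -/
local notation3 (prettyPrint := false) "𝓲(" u ")" => (fun i : K3Index => ((u i : ℤ) : ℂ))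

/-- `πU[u₁, u₂]`: the `k3Form`-orthogonal projector `y ↦ (y.u₂)u₁ + (y.u₁)u₂` onto the hyperbolic plane
`ℂu₁ ⊕ ℂu₂` (for `(u₁.u₁) = (u₂.u₂) = 0`, `(u₁.u₂) = 1`). Local notation only. -/
local notation3 (prettyPrint := false) "πU[" u₁ ", " u₂ "]" =>
  ((LinearMap.smulRight (k3FormC (fun i : K3Index => ((u₂ i : ℤ) : ℂ))) (fun i : K3Index => ((u₁ i : ℤ) : ℂ)) +
      LinearMap.smulRight (k3FormC (fun i : K3Index => ((u₁ i : ℤ) : ℂ))) (fun i : K3Index => ((u₂ i : ℤ) : ℂ)) :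
    Module.End ℂ (K3Index → ℂ)))

/-- `Q₁₁ = (X - 2)(X⁵ + X⁴ - 4X³ - 3X² + 3X + 1) ∈ ℚ[X]`: `X - 2` times the minimal polynomial of `ζ₁₁ + ζ₁₁⁻¹`.
Local notation only. -/
local notation3 (prettyPrint := false) "Q₁₁" =>
  ((X - C (2 : ℚ)) * (X ^ 5 + X ^ 4 - C (4 : ℚ) * X ^ 3 - C (3 : ℚ) * X ^ 2 + C (3 : ℚ) * X + 1) : ℚ[X])

variable {g : Module.End ℂ (K3Index → ℂ)} {u₁ u₂ : K3Index → ℤ} {y₀ : K3Index → ℂ}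
  {θ : Matrix K3Index K3Index ℚ} {S : SchemeOver ℂ}

/-! ### The `(2,0)`-eigenvalue is non-zero; `ρ(S) = 2` -/

/-- `θ_ℂ` is `k3Form`-self-adjoint for a ζ₁₁ datum (restated from `selfAdjoint_of_zeta11Model`). [folklore] -/
theorem thetaC_selfAdjoint_of_zeta11Model (hZ : Zeta11Model[g, u₁, u₂, y₀, θ]) (a b : K3Index → ℂ) :
    k3Form (thetaC θ a) b = k3Form a (thetaC θ b) :=
  selfAdjoint_of_zeta11Model hZ.1 hZ.2.2.1 hZ.2.2.2.2.2.2.2.2.2.2.2.2 a b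

/-- The lattice vectors `u` are REAL in `Λ_ℂ`. [folklore] -/
theorem star_intVec (u : K3Index → ℤ) : star 𝓲(u) = 𝓲(u) := by
  funext i
  simp only [Pi.star_apply, star_intCast]

/-- **The `(2,0)`-eigenvalue of an endomorphism conjugate to a ζ₁₁ model is non-zero.** For a marked
projective K3 surface `(S, η, p, x)`, an endomorphism `t` killing `N¹(S)` with `t(η⁻¹x) = ev·η⁻¹x`, and a
rational isometry `σ` with `σηt = θ_ℂση`: `ev ≠ 0`. Otherwise `σx ∈ ker θ_ℂ = ℂu₁ ⊕ ℂu₂`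
(`thetaC_apply_eq_zero_iff`), `σx = a u₁ + b u₂` with `2ab = (σx.σx) = (x.x) = 0`, and then
`(σx̄.σx) = āb + b̄a = 0` — contradicting `(x̄.x) > 0` (`σ` is a real isometry). A period cannot lie in a
rational hyperbolic plane. Fact-free. [cite: Huybrechts2016K3, Ch. 6 §1.1] [cite: GeemenSchutt2023, §2.1] -/
theorem eigenvalue_ne_zero_of_zeta11Model (hZ : Zeta11Model[g, u₁, u₂, y₀, θ])
    (η : complexBetti S (2 * 1) ≃ₗ[ℂ] (K3Index → ℂ)) (p : complexBetti S (2 * 2)) (x : K3Index → ℂ)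
    (hM : MarkedK3[S, η, p, x])
    (t : complexBetti S (2 * 1) →ₗ[ℂ] complexBetti S (2 * 1))
    (σ : Module.End ℂ (K3Index → ℂ)) (hσ : ∀ a b, k3Form (σ a) (σ b) = k3Form a b)
    (hσrat : ∀ v : K3Index → ℤ, ∃ w : K3Index → ℚ, σ (fun i => (v i : ℂ)) = fun i => (w i : ℂ))
    (hconj : ∀ c : complexBetti S (2 * 1), σ (η (t c)) = thetaC θ (σ (η c)))
    {ev : ℂ} (hev : t (η.symm x) = ev • η.symm x) : ev ≠ 0 := by
  classical
  intro hev0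
  have hu₁₁ := hZ.2.2.2.2.2.1
  have hu₂₂ := hZ.2.2.2.2.2.2.1
  have hu₁₂ := hZ.2.2.2.2.2.2.2.1
  have hPer := hM.2.2
  -- `θ (σ x) = 0`, so `π_U (σ x) = σ x`
  have hθσx : thetaC θ (σ x) = 0 := by
    have h := hconj (η.symm x)
    rw [hev, hev0, zero_smul, map_zero, map_zero, LinearEquiv.apply_symm_apply] at h
    exact h.symm
  have hπ : πU[u₁, u₂] (σ x) = σ x := (thetaC_apply_eq_zero_iff hZ _).1 hθσx
  set a : ℂ := k3Form (σ x) 𝓲(u₂) with ha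
  set b : ℂ := k3Form (σ x) 𝓲(u₁) with hb
  have hdec : σ x = a • 𝓲(u₁) + b • 𝓲(u₂) := by rw [← hπ, piU_apply]
  -- isotropy: `2ab = 0`
  have hiso : a * b = 0 := by
    have h0 : k3Form (σ x) (σ x) = 0 := by rw [hσ, hPer.1]
    rw [hdec] at h0
    simp only [k3Form_add_left, k3Form_add_right, k3Form_smul_left, k3Form_smul_right, hu₁₁, hu₂₂, hu₁₂,
      k3Form_comm 𝓲(u₂) 𝓲(u₁)] at h0
    linear_combination (1 / 2 : ℂ) * h0
  -- positivity: `(σx̄ . σx) = (x̄ . x) > 0`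
  have hpos : 0 < (k3Form (star (σ x)) (σ x)).re := by
    rw [star_apply_ratIsometry σ hσ hσrat x, hσ]
    exact hPer.2.1
  have hval : k3Form (star (σ x)) (σ x) = star a * b + star b * a := by
    conv_lhs => rw [hdec]
    rw [star_add, star_smul, star_smul, star_intVec, star_intVec]
    simp only [k3Form_add_left, k3Form_add_right, k3Form_smul_left, k3Form_smul_right, hu₁₁, hu₂₂, hu₁₂,
      k3Form_comm 𝓲(u₂) 𝓲(u₁)]
    ring
  rcases mul_eq_zero.1 hiso with h | h
  · rw [hval, h, star_zero, zero_mul, mul_zero, add_zero, Complex.zero_re] at hpos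
    exact lt_irrefl _ hpos
  · rw [hval, h, star_zero, zero_mul, mul_zero, zero_add, Complex.zero_re] at hpos
    exact lt_irrefl _ hpos

/-- **A K3 surface of the ζ₁₁ rational real-multiplication type has Picard number `2`.** For a marked
projective K3 surface `(S, η, p, x)` with an endomorphism `t` (type-preserving, killing `N¹(S)`) conjugate by a
rational isometry `σ` of `Λ_ℚ` to a ζ₁₁ model `θ_ℂ`: `ρ(S) = dim_ℂ N¹H²(S(ℂ); ℂ) = 2`. `ση` maps `N¹(S)_ℂ`
into `ker θ_ℂ` (as `t` kills `N¹`), and ONTO: `ker θ_ℂ = ℂu₁ ⊕ ℂu₂` is spanned by rational vectors, each the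
image of an algebraic class (`exists_mem_algebraicClasses_of_ratCast_mem_ker_of_ne_zero`, Lefschetz `(1,1)`,
`ev ≠ 0`); `dim ker θ_ℂ = 2`. Fact-free; in particular NO base change and no use of the integral
fixed-lattice clause. [cite: GeemenSchutt2023, Thm. 1.1 (11) and §5.8] [cite: Huybrechts2016K3, Ch. 3 §3.2] -/
theorem finrank_algebraicClasses_eq_two_of_zeta11Model (hZ : Zeta11Model[g, u₁, u₂, y₀, θ])
    (hS : IsK3Surface S)
    (η : complexBetti S (2 * 1) ≃ₗ[ℂ] (K3Index → ℂ)) (p : complexBetti S (2 * 2)) (x : K3Index → ℂ)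
    (hM : MarkedK3[S, η, p, x])
    (t : complexBetti S (2 * 1) →ₗ[ℂ] complexBetti S (2 * 1))
    (ht_typ : ∀ (i j : ℕ) (y : complexBetti S (2 * 1)),
      IsOfHodgeType 2 S (2 * 1) i j y → IsOfHodgeType 2 S (2 * 1) i j (t y))
    (ht_N : ∀ d ∈ algebraicClasses S 1, t d = 0)
    (σ : Module.End ℂ (K3Index → ℂ)) (hσ : ∀ a b, k3Form (σ a) (σ b) = k3Form a b)
    (hσrat : ∀ v : K3Index → ℤ, ∃ w : K3Index → ℚ, σ (fun i => (v i : ℂ)) = fun i => (w i : ℂ))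
    (hconj : ∀ c : complexBetti S (2 * 1), σ (η (t c)) = thetaC θ (σ (η c))) :
    Module.finrank ℂ ↥(algebraicClasses S 1) = 2 := by
  classical
  have hθsa := thetaC_selfAdjoint_of_zeta11Model hZ
  obtain ⟨hp0, ⟨hpint, hpgen, hηint, hηcup, h20, hline⟩, hPer⟩ := hM
  obtain ⟨ev, hev⟩ := hline (t (η.symm x)) (ht_typ 2 0 _ h20)
  have hM' : MarkedK3[S, η, p, x] := ⟨hp0, ⟨hpint, hpgen, hηint, hηcup, h20, hline⟩, hPer⟩
  have hev0 : ev ≠ 0 := eigenvalue_ne_zero_of_zeta11Model hZ η p x hM' t σ hσ hσrat hconj hev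
  set A : complexBetti S (2 * 1) →ₗ[ℂ] (K3Index → ℂ) := σ ∘ₗ η.toLinearMap with hA
  have hAapp : ∀ c, A c = σ (η c) := fun c => rfl
  have hσinj : Function.Injective σ := injective_of_k3Form_isometry σ hσ
  have hAinj : Function.Injective A := fun a b hab => η.injective (hσinj hab)
  set N := algebraicClasses S 1 with hNdef
  have hle : N.map A ≤ LinearMap.ker (thetaC θ) := by
    rintro w ⟨d, hd, rfl⟩
    rw [LinearMap.mem_ker, hAapp, ← hconj, ht_N d hd, map_zero, map_zero]
  have hge : LinearMap.ker (thetaC θ) ≤ N.map A := by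
    refine (ker_thetaC_le_span_ratCast_of_zeta11Model hZ).trans (Submodule.span_le.2 ?_)
    rintro w ⟨⟨q, rfl⟩, hq⟩
    obtain ⟨d, hd, hdq⟩ := exists_mem_algebraicClasses_of_ratCast_mem_ker_of_ne_zero hθsa hS η p x hM' t σ hσ
      hσrat hconj hev hev0 q hq
    exact ⟨d, hd, hdq⟩
  have heq : N.map A = LinearMap.ker (thetaC θ) := le_antisymm hle hge
  rw [LinearEquiv.finrank_eq (Submodule.equivMapOfInjective A hAinj N), heq]
  exact finrank_ker_thetaC_of_zeta11Model hZ

/-! ### `Q₁₁ = (X - 2)·P₁₁` annihilates `t` on `T(S)` -/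

/-- For a transcendental class `y` (cup-orthogonal to `N¹(S)`), `ση(y)` is `k3Form`-orthogonal to `u₁` and
`u₂` — each `uᵢ = ση(dᵢ)` for an algebraic `dᵢ` — so `π_U(ση y) = 0`. [cite: GeemenSchutt2023, §2.1] -/
theorem piU_apply_eq_zero_of_transcendental (hZ : Zeta11Model[g, u₁, u₂, y₀, θ]) (hS : IsK3Surface S)
    (η : complexBetti S (2 * 1) ≃ₗ[ℂ] (K3Index → ℂ)) (p : complexBetti S (2 * 2)) (x : K3Index → ℂ)
    (hM : MarkedK3[S, η, p, x])
    (t : complexBetti S (2 * 1) →ₗ[ℂ] complexBetti S (2 * 1))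
    (ht_typ : ∀ (i j : ℕ) (y : complexBetti S (2 * 1)),
      IsOfHodgeType 2 S (2 * 1) i j y → IsOfHodgeType 2 S (2 * 1) i j (t y))
    (σ : Module.End ℂ (K3Index → ℂ)) (hσ : ∀ a b, k3Form (σ a) (σ b) = k3Form a b)
    (hσrat : ∀ v : K3Index → ℤ, ∃ w : K3Index → ℚ, σ (fun i => (v i : ℂ)) = fun i => (w i : ℂ))
    (hconj : ∀ c : complexBetti S (2 * 1), σ (η (t c)) = thetaC θ (σ (η c)))
    {y : complexBetti S (2 * 1)}
    (hy : ∀ d ∈ algebraicClasses S 1, cupProduct (rfl : 2 * 1 + 2 * 1 = 2 * 2) y d = 0) :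
    πU[u₁, u₂] (σ (η y)) = 0 := by
  classical
  have hθsa := thetaC_selfAdjoint_of_zeta11Model hZ
  obtain ⟨hp0, ⟨hpint, hpgen, hηint, hηcup, h20, hline⟩, hPer⟩ := hM
  obtain ⟨ev, hev⟩ := hline (t (η.symm x)) (ht_typ 2 0 _ h20)
  have hM' : MarkedK3[S, η, p, x] := ⟨hp0, ⟨hpint, hpgen, hηint, hηcup, h20, hline⟩, hPer⟩
  have hev0 : ev ≠ 0 := eigenvalue_ne_zero_of_zeta11Model hZ η p x hM' t σ hσ hσrat hconj hev
  have horth : ∀ u : K3Index → ℤ, thetaC θ 𝓲(u) = 0 → k3Form (σ (η y)) 𝓲(u) = 0 := by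
    intro u hu
    have hq : thetaC θ (fun i => (((u i : ℤ) : ℚ) : ℂ)) = 0 := by
      have e : (fun i : K3Index => (((u i : ℤ) : ℚ) : ℂ)) = 𝓲(u) := funext fun i => by simp
      rw [e, hu]
    obtain ⟨d, hd, hdq⟩ := exists_mem_algebraicClasses_of_ratCast_mem_ker_of_ne_zero hθsa hS η p x hM' t σ hσ
      hσrat hconj hev hev0 _ hq
    have e' : 𝓲(u) = σ (η d) := by rw [hdq]; funext i; simp
    rw [e', hσ]
    have hcup := hy d hd
    rw [hηcup] at hcup
    exact (smul_eq_zero.1 hcup).resolve_right hp0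
  rw [piU_apply, horth u₁ (thetaC_u1 hZ), horth u₂ (thetaC_u2 hZ), zero_smul, zero_smul, add_zero]

/-- **`Q₁₁(t) = 0` on `T(S)`** for `Q₁₁ = (X - 2)(X⁵ + X⁴ - 4X³ - 3X² + 3X + 1)`, for every marked projective
K3 surface whose endomorphism `t` (type-preserving, killing `N¹(S)`) is conjugate by a rational isometry `σ` to
a ζ₁₁ model `θ_ℂ`: `A = ση` maps `T(S)` into `ker π_U` (`piU_apply_eq_zero_of_transcendental`), where
`Q₁₁(θ_ℂ)` vanishes (`aeval_thetaC_sextic_apply_of_piU_eq_zero`: `θ_ℂ = (g + g¹⁰)` there and `g¹¹ = 1`);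
pull back along the injective `A`. The factor `X - 2` accounts for possible `g`-fixed vectors off `U` over
`ℂ` (none exist, but that is not needed). Fact-free. [cite: GeemenSchutt2023, Thm. 1.1 (11), §2.1] -/
theorem isAnnihilatedOnTranscendentalBy_sextic_of_zeta11Model (hZ : Zeta11Model[g, u₁, u₂, y₀, θ])
    (hS : IsK3Surface S)
    (η : complexBetti S (2 * 1) ≃ₗ[ℂ] (K3Index → ℂ)) (p : complexBetti S (2 * 2)) (x : K3Index → ℂ)
    (hM : MarkedK3[S, η, p, x])
    (t : complexBetti S (2 * 1) →ₗ[ℂ] complexBetti S (2 * 1))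
    (ht_typ : ∀ (i j : ℕ) (y : complexBetti S (2 * 1)),
      IsOfHodgeType 2 S (2 * 1) i j y → IsOfHodgeType 2 S (2 * 1) i j (t y))
    (σ : Module.End ℂ (K3Index → ℂ)) (hσ : ∀ a b, k3Form (σ a) (σ b) = k3Form a b)
    (hσrat : ∀ v : K3Index → ℤ, ∃ w : K3Index → ℚ, σ (fun i => (v i : ℂ)) = fun i => (w i : ℂ))
    (hconj : ∀ c : complexBetti S (2 * 1), σ (η (t c)) = thetaC θ (σ (η c))) :
    IsAnnihilatedOnTranscendentalBy S t (Q₁₁) := by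
  classical
  intro y hy
  have hσinj : Function.Injective σ := injective_of_k3Form_isometry σ hσ
  have hπ := piU_apply_eq_zero_of_transcendental hZ hS η p x hM t ht_typ σ hσ hσrat hconj hy
  have hQ := aeval_thetaC_sextic_apply_of_piU_eq_zero hZ hπ
  have hconjQ := conj_aeval_apply η t σ hconj ((Q₁₁).map (algebraMap ℚ ℂ)) y
  rw [hQ] at hconjQ
  exact η.injective (hσinj (by rw [map_zero, map_zero]; exact hconjQ))

end Summit.HodgeConjecture.HodgeConjecture.Theorems.MarkmanPartnerTransport.RMTypeOrbit

end
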